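import Summits.BirchSwinnertonDyer.Rank1Residual.GaloisImage.CongruenceVisibilityIdentityComponentRecord
import Summits.BirchSwinnertonDyer.Rank1Residual.GaloisImage.CubicRootStabilizerThree
import Literature.NumberTheory.EllipticCurves.CongruenceVisibilityLocalFactors
import Literature.NumberTheory.EllipticCurves.Rank1Residual.AnomalousDictionaryProofs
import Literature.NumberTheory.EllipticCurves.TorsionFrobeniusProofs
import HarnessLib

/-!
# THEOREM B record shapes over `ℚ` at `v₀ = 3` (cell `b2b-bsdres`, team n1011, seat p10 GEN 8;
# FILE 8d: the `ℚ` wrappers of FILES 8b/8c)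

HONEST FRAMING (cell `b2b-bsdres`, run/shared/lean/b2b/bsd-rank1-residual/, verbatim in every
file): the goal of the cell is to DELETE the COMBINATION-SHAPED residual classes of the
Birch–Swinnerton-Dyer formula for ALL analytic-rank `≤ 1` elliptic curves over `ℚ` — "full BSD
formula for every rank `≤ 1` curve in class `C`" assembled STRICTLY from published theorems — so
that the rank-`≤ 1` remainder becomes exactly the CONSTRUCTION-SHAPED classes, which are TYPED
(missing-input `Prop`s), NOT attempted. This is not "finishing BSD". Team n1011 (N10 / N11):
research route on the CONSTRUCTION-SHAPED class X4 (§I N11 LOWER half); no claim beyond the stated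
classes; nothing is booked; marks UNCHANGED. Theorems only: no definition, no named fact, no
`sorry`. RECORD-SHAPE theorems; they close nothing by themselves.

## What

Over `ℚ` with `primesEquiv v₀ = 3` the side inputs of the number-field record shapes
`exists_sha_ne_zero_of_congr_of_identityComponent[_of_torsionIntegral]` (FILES 8b, 8c) are
discharged: `3 ∈ v₀` (`natCast_mem_asIdeal_of_primesEquiv_eq`), `#(ℤ₃/3) = 3`
(`prod_natCard_quot_adicCompletionIntegers`), and the three `ℚ₃`-facts (`−23` square, `−3`
non-square, `X³ − X − 1` rootless: FILE 5 `three_facts_adicCompletion_three`). The hypothesis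
`hind` on `E'(ℚ)` is stated with `ℚ`'s decidable equality and converted to the classical one of
the tree's Mordell–Weil group law (`Subsingleton (DecidableEq ℚ)`), as in FILE 6.

## How a record uses this (referee-1 GEN 39 provisos (ii)–(vi))

A per-row record file displays: `θ, hθ` (the `3`-congruence, KO/Hesse certificate as in the
visibility records), `S, hS`, `hfin, hcop` BY NAME from the rank-`0` side, `P₁, P₂, hind` (two
points of `E'(ℚ)` independent modulo `3E'(ℚ)`: four non-divisibility certificates), `hoff` at EVERY
bad place `v ≠ 3` of `S` (the free kinds of the witness records), `hcard, hcard'` (T-LOC3L), and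
per curve the integral model `M` at `3` with `hC`, its cusp `(x₀, y₀, a, hcusp)` and EITHER the
σ-decider certificate `(a₀, b₀, hns₀, hm, h3)` (plain form, `…_rat`; T-SIG3-TRI FILE 2) OR the
point-level form `hE0` (`…_of_torsionIntegral_rat`); the record says which. Milne I.3.8 /
Cremona–Mazur are anchors of the method, not inputs.

References: L41-NOTE §§1–2.
-/

noncomputable section

open scoped Classical

namespace Summit.BirchSwinnertonDyer.Rank1Residual.GaloisImage.TwistedWitness

open WeierstrassCurve Literature.NumberTheory.EllipticCurves Literature.NumberTheory.GaloisRepresentations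
open Field NumberField IsDedekindDomain IsDedekindDomain.HeightOneSpectrum Rat.HeightOneSpectrum


/-! ## Independence modulo `3` from four non-divisibility certificates -/

section Indep

variable {A : Type*} [AddCommGroup A]

/-- **`hind` from four certificates.** In an abelian group, if `P₁, P₂, P₁ + P₂, P₁ + 2 • P₂` are
all outside `3A` (`2 •` is the `ℤ`-action), then `c₁ • P₁ + c₂ • P₂ ∈ 3A` forces `3 ∣ c₁` and `3 ∣ c₂` (the eight non-zero
classes of `(ℤ/3)²` are these four up to sign). This is how a record discharges the binder `hind`
of the THEOREM B shapes from reduction-mod-`ℓ` non-divisibility certificates. [folklore] -/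
theorem dvd_and_dvd_of_zsmul_add_zsmul_mem (P₁ P₂ : A)
    (h10 : P₁ ∉ (zsmulAddGroupHom ((3 : ℕ) : ℤ) : A →+ A).range)
    (h01 : P₂ ∉ (zsmulAddGroupHom ((3 : ℕ) : ℤ) : A →+ A).range)
    (h11 : P₁ + P₂ ∉ (zsmulAddGroupHom ((3 : ℕ) : ℤ) : A →+ A).range)
    (h12 : P₁ + (2 : ℤ) • P₂ ∉ (zsmulAddGroupHom ((3 : ℕ) : ℤ) : A →+ A).range)
    (c₁ c₂ : ℤ) (hc : c₁ • P₁ + c₂ • P₂ ∈ (zsmulAddGroupHom ((3 : ℕ) : ℤ) : A →+ A).range) :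
    (3 : ℤ) ∣ c₁ ∧ (3 : ℤ) ∣ c₂ := by
  set R := (zsmulAddGroupHom ((3 : ℕ) : ℤ) : A →+ A).range with hR
  have hmemR : ∀ x : A, x ∈ R ↔ ∃ y : A, (3 : ℤ) • y = x := fun x ↦ by
    rw [hR, AddMonoidHom.mem_range]
    exact ⟨fun ⟨y, hy⟩ ↦ ⟨y, by simpa using hy⟩, fun ⟨y, hy⟩ ↦ ⟨y, by simpa using hy⟩⟩
  have h3R : ∀ y : A, (3 : ℤ) • y ∈ R := fun y ↦ (hmemR _).mpr ⟨y, rfl⟩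
  -- reduce the coefficients modulo `3`
  set r₁ := c₁ % 3 with hr₁
  set r₂ := c₂ % 3 with hr₂
  have e₁ : c₁ = 3 * (c₁ / 3) + r₁ := by omega
  have e₂ : c₂ = 3 * (c₂ / 3) + r₂ := by omega
  have hred : r₁ • P₁ + r₂ • P₂ ∈ R := by
    have f₁ : r₁ = c₁ - 3 * (c₁ / 3) := by omega
    have f₂ : r₂ = c₂ - 3 * (c₂ / 3) := by omega
    have e : r₁ • P₁ + r₂ • P₂ =
        (c₁ • P₁ + c₂ • P₂) - (3 : ℤ) • ((c₁ / 3) • P₁ + (c₂ / 3) • P₂) := by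
      rw [f₁, f₂]
      module
    rw [e]
    exact R.sub_mem hc (h3R _)
  have hr₁b : r₁ = 0 ∨ r₁ = 1 ∨ r₁ = 2 := by omega
  have hr₂b : r₂ = 0 ∨ r₂ = 1 ∨ r₂ = 2 := by omega
  -- the eight non-zero residue pairs contradict one of the four certificates
  have key : r₁ = 0 ∧ r₂ = 0 := by
    -- helper: `2 • X ∈ R → X ∈ R`
    have htwo : ∀ X : A, (2 : ℤ) • X ∈ R → X ∈ R := fun X hX ↦ by
      have e : X = (3 : ℤ) • X - (2 : ℤ) • X := by module
      rw [e]; exact R.sub_mem (h3R X) hX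
    rcases hr₁b with h1 | h1 | h1 <;> rcases hr₂b with h2 | h2 | h2 <;> rw [h1, h2] at hred
    · exact ⟨h1, h2⟩
    · exact absurd (by simpa using hred) h01
    · exact absurd (htwo P₂ (by simpa using hred)) h01
    · exact absurd (by simpa using hred) h10
    · exact absurd (by simpa using hred) h11
    · refine absurd ?_ h12
      simpa using hred
    · exact absurd (htwo P₁ (by simpa using hred)) h10
    · -- `2 • P₁ + P₂ ∈ R ⇒ P₁ + 2 • P₂ = 2 • (2 • P₁ + P₂) - 3 • P₁ ∈ R`
      refine absurd ?_ h12
      have hx : (2 : ℤ) • P₁ + (1 : ℤ) • P₂ ∈ R := hred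
      have e : P₁ + (2 : ℤ) • P₂ = (2 : ℤ) • ((2 : ℤ) • P₁ + (1 : ℤ) • P₂) - (3 : ℤ) • P₁ := by module
      rw [e]; exact R.sub_mem (R.zsmul_mem hx 2) (h3R P₁)
    · -- `2 • (P₁ + P₂) ∈ R ⇒ P₁ + P₂ ∈ R`
      refine absurd (htwo (P₁ + P₂) ?_) h11
      have hx : (2 : ℤ) • P₁ + (2 : ℤ) • P₂ ∈ R := hred
      rwa [← zsmul_add] at hx
  constructor
  · rw [e₁, key.1, add_zero]; exact dvd_mul_right 3 _
  · rw [e₂, key.2, add_zero]; exact dvd_mul_right 3 _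

end Indep

/-- `#(ℤ₃ / 3ℤ₃) = 3` for the place `v₀` of `ℚ` above `3`. [folklore] -/
theorem natCard_quot_three_of_primesEquiv_eq {v₀ : HeightOneSpectrum (𝓞 ℚ)}
    (hv₀ : (primesEquiv v₀ : ℕ) = 3) :
    Nat.card (v₀.adicCompletionIntegers ℚ ⧸
      Ideal.span {((3 : ℕ) : v₀.adicCompletionIntegers ℚ)}) = 3 := by
  haveI : Fact (Nat.Prime 3) := ⟨Nat.prime_three⟩
  have h := prod_natCard_quot_adicCompletionIntegers (K := ℚ) (p := 3) {v₀} (fun v hv h3 ↦ hv ?_)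
  · rw [Finset.prod_singleton, Module.finrank_self, pow_one] at h
    exact h
  · rw [Finset.mem_singleton]
    apply (primesEquiv (R := 𝓞 ℚ)).injective
    apply Subtype.ext
    rw [Literature.NumberTheory.EllipticCurves.primesEquiv_eq_of_natCast_mem Nat.prime_three h3, hv₀]

/-- **THEOREM B record shape over `ℚ` at `3`** (FILE 8b specialised; per-curve identity-component
data `(M, C, hC, x₀ y₀ a, hcusp, a₀ b₀, hns₀, hm, h3)` as delivered by the σ-decider).
[cite: CremonaMazur2000, §3 pp. 19–22] [cite: MilneADT2006, Ch. I Prop. 3.8 and Lemma 3.3] -/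
theorem exists_sha_ne_zero_of_congr_of_identityComponent_rat (W W' : WeierstrassCurve ℚ)
    [W.IsElliptic] [W'.IsElliptic]
    (θ : geomTorsion W' ((3 : ℕ) : ℤ) ≃+ geomTorsion W ((3 : ℕ) : ℤ))
    (hθ : ∀ (σ : absoluteGaloisGroup ℚ) (P : geomTorsion W' ((3 : ℕ) : ℤ)), θ (σ • P) = σ • θ P)
    (S : Finset (HeightOneSpectrum (𝓞 ℚ)))
    (hS : ∀ v : HeightOneSpectrum (𝓞 ℚ), v ∉ S →
      W.HasGoodReductionAt v ∧ W'.HasGoodReductionAt v ∧ ((3 : ℕ) : 𝓞 ℚ) ∉ v.asIdeal)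
    (hfin : Finite W.toAffine.Point) (hcop : (Nat.card W.toAffine.Point).Coprime 3)
    (P₁ P₂ : W'.toAffine.Point)
    (hind : ∀ c₁ c₂ : ℤ, c₁ • P₁ + c₂ • P₂ ∈
      (zsmulAddGroupHom ((3 : ℕ) : ℤ) : W'.toAffine.Point →+ W'.toAffine.Point).range →
      (3 : ℤ) ∣ c₁ ∧ (3 : ℤ) ∣ c₂)
    (v₀ : HeightOneSpectrum (𝓞 ℚ)) (hv₀ : (primesEquiv v₀ : ℕ) = 3)
    (hoff : ∀ v ∈ S, v ≠ v₀ →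
      (selmerLocalKer W (v.adicCompletion ℚ) ((3 : ℕ) : ℤ)).relIndex
        ((selmerLocalKer W' (v.adicCompletion ℚ) ((3 : ℕ) : ℤ)).map (h1Equiv θ hθ).toAddMonoidHom) = 1)
    (hcard : Nat.card (nsmulAddMonoidHom 3 :
      (W.baseChange (v₀.adicCompletion ℚ)).toAffine.Point →+ _).ker = 3)
    (hcard' : Nat.card (nsmulAddMonoidHom 3 :
      (W'.baseChange (v₀.adicCompletion ℚ)).toAffine.Point →+ _).ker = 3)
    (M : WeierstrassCurve (v₀.adicCompletionIntegers ℚ)) (C : VariableChange (v₀.adicCompletion ℚ))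
    (hC : C • W.baseChange (v₀.adicCompletion ℚ) =
      M.map (algebraMap (v₀.adicCompletionIntegers ℚ) (v₀.adicCompletion ℚ)))
    (x₀ y₀ a : IsLocalRing.ResidueField (v₀.adicCompletionIntegers ℚ))
    (hcusp : M.map (IsLocalRing.residue (v₀.adicCompletionIntegers ℚ)) = singularModel x₀ y₀ a a)
    {a₀ b₀ : v₀.adicCompletionIntegers ℚ}
    (hns₀ : (M.map (IsLocalRing.residue (v₀.adicCompletionIntegers ℚ))).toAffine.Nonsingular
      (IsLocalRing.residue (v₀.adicCompletionIntegers ℚ) a₀)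
      (IsLocalRing.residue (v₀.adicCompletionIntegers ℚ) b₀))
    (hm : ((M.map (algebraMap (v₀.adicCompletionIntegers ℚ) (v₀.adicCompletion ℚ))).baseChange
        (AlgebraicClosure (v₀.adicCompletion ℚ))).toAffine.Nonsingular
      (algebraMap (v₀.adicCompletionIntegers ℚ) (AlgebraicClosure (v₀.adicCompletion ℚ)) a₀)
      (algebraMap (v₀.adicCompletionIntegers ℚ) (AlgebraicClosure (v₀.adicCompletion ℚ)) b₀))
    (h3 : (3 : ℤ) • (Affine.Point.some _ _ hm :
      ((M.map (algebraMap (v₀.adicCompletionIntegers ℚ) (v₀.adicCompletion ℚ))).baseChange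
        (AlgebraicClosure (v₀.adicCompletion ℚ))).toAffine.Point) = 0)
    (M' : WeierstrassCurve (v₀.adicCompletionIntegers ℚ)) (C' : VariableChange (v₀.adicCompletion ℚ))
    (hC' : C' • W'.baseChange (v₀.adicCompletion ℚ) =
      M'.map (algebraMap (v₀.adicCompletionIntegers ℚ) (v₀.adicCompletion ℚ)))
    (x₀' y₀' a' : IsLocalRing.ResidueField (v₀.adicCompletionIntegers ℚ))
    (hcusp' : M'.map (IsLocalRing.residue (v₀.adicCompletionIntegers ℚ)) = singularModel x₀' y₀' a' a')
    {a₀' b₀' : v₀.adicCompletionIntegers ℚ}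
    (hns₀' : (M'.map (IsLocalRing.residue (v₀.adicCompletionIntegers ℚ))).toAffine.Nonsingular
      (IsLocalRing.residue (v₀.adicCompletionIntegers ℚ) a₀')
      (IsLocalRing.residue (v₀.adicCompletionIntegers ℚ) b₀'))
    (hm' : ((M'.map (algebraMap (v₀.adicCompletionIntegers ℚ) (v₀.adicCompletion ℚ))).baseChange
        (AlgebraicClosure (v₀.adicCompletion ℚ))).toAffine.Nonsingular
      (algebraMap (v₀.adicCompletionIntegers ℚ) (AlgebraicClosure (v₀.adicCompletion ℚ)) a₀')
      (algebraMap (v₀.adicCompletionIntegers ℚ) (AlgebraicClosure (v₀.adicCompletion ℚ)) b₀'))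
    (h3' : (3 : ℤ) • (Affine.Point.some _ _ hm' :
      ((M'.map (algebraMap (v₀.adicCompletionIntegers ℚ) (v₀.adicCompletion ℚ))).baseChange
        (AlgebraicClosure (v₀.adicCompletion ℚ))).toAffine.Point) = 0) :
    ∃ c : W.sha, c ≠ 0 ∧ 3 • c = 0 := by
  obtain ⟨⟨δ, hδ⟩, hn3, hnoroot⟩ := three_facts_adicCompletion_three hv₀
  exact exists_sha_ne_zero_of_congr_of_identityComponent W W' θ hθ S hS hfin hcop P₁ P₂
    (fun c₁ c₂ h ↦ hind c₁ c₂ (by convert h))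
    v₀ (Literature.NumberTheory.EllipticCurves.Rank1Residual.natCast_mem_asIdeal_of_primesEquiv_eq hv₀)
    (natCard_quot_three_of_primesEquiv_eq hv₀) hδ hnoroot hn3 hoff hcard hcard'
    M C hC x₀ y₀ a hcusp hns₀ hm h3 M' C' hC' x₀' y₀' a' hcusp' hns₀' hm' h3'

/-- **THEOREM B record shape over `ℚ` at `3` with the σ-decider on `ℚ₃`-points** (FILE 8c
specialised). [cite: CremonaMazur2000, §3 pp. 19–22] [cite: MilneADT2006, Ch. I Prop. 3.8 and Lemma 3.3] -/
theorem exists_sha_ne_zero_of_congr_of_identityComponent_of_torsionIntegral_rat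
    (W W' : WeierstrassCurve ℚ) [W.IsElliptic] [W'.IsElliptic]
    (θ : geomTorsion W' ((3 : ℕ) : ℤ) ≃+ geomTorsion W ((3 : ℕ) : ℤ))
    (hθ : ∀ (σ : absoluteGaloisGroup ℚ) (P : geomTorsion W' ((3 : ℕ) : ℤ)), θ (σ • P) = σ • θ P)
    (S : Finset (HeightOneSpectrum (𝓞 ℚ)))
    (hS : ∀ v : HeightOneSpectrum (𝓞 ℚ), v ∉ S →
      W.HasGoodReductionAt v ∧ W'.HasGoodReductionAt v ∧ ((3 : ℕ) : 𝓞 ℚ) ∉ v.asIdeal)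
    (hfin : Finite W.toAffine.Point) (hcop : (Nat.card W.toAffine.Point).Coprime 3)
    (P₁ P₂ : W'.toAffine.Point)
    (hind : ∀ c₁ c₂ : ℤ, c₁ • P₁ + c₂ • P₂ ∈
      (zsmulAddGroupHom ((3 : ℕ) : ℤ) : W'.toAffine.Point →+ W'.toAffine.Point).range →
      (3 : ℤ) ∣ c₁ ∧ (3 : ℤ) ∣ c₂)
    (v₀ : HeightOneSpectrum (𝓞 ℚ)) (hv₀ : (primesEquiv v₀ : ℕ) = 3)
    (hoff : ∀ v ∈ S, v ≠ v₀ →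
      (selmerLocalKer W (v.adicCompletion ℚ) ((3 : ℕ) : ℤ)).relIndex
        ((selmerLocalKer W' (v.adicCompletion ℚ) ((3 : ℕ) : ℤ)).map (h1Equiv θ hθ).toAddMonoidHom) = 1)
    (hcard : Nat.card (nsmulAddMonoidHom 3 :
      (W.baseChange (v₀.adicCompletion ℚ)).toAffine.Point →+ _).ker = 3)
    (hcard' : Nat.card (nsmulAddMonoidHom 3 :
      (W'.baseChange (v₀.adicCompletion ℚ)).toAffine.Point →+ _).ker = 3)
    (M : WeierstrassCurve (v₀.adicCompletionIntegers ℚ)) (C : VariableChange (v₀.adicCompletion ℚ))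
    (hC : C • W.baseChange (v₀.adicCompletion ℚ) =
      M.map (algebraMap (v₀.adicCompletionIntegers ℚ) (v₀.adicCompletion ℚ)))
    (x₀ y₀ a : IsLocalRing.ResidueField (v₀.adicCompletionIntegers ℚ))
    (hcusp : M.map (IsLocalRing.residue (v₀.adicCompletionIntegers ℚ)) = singularModel x₀ y₀ a a)
    (hE0 : ∀ T : (W.baseChange (v₀.adicCompletion ℚ)).toAffine.Point, 3 • T = 0 → T ≠ 0 →
      ∃ (a₀ b₀ : v₀.adicCompletionIntegers ℚ)
        (h : (M.map (algebraMap (v₀.adicCompletionIntegers ℚ) (v₀.adicCompletion ℚ))).toAffine.Nonsingular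
          (a₀ : v₀.adicCompletion ℚ) (b₀ : v₀.adicCompletion ℚ)),
        Affine.Point.congrEquiv hC (VariableChange.pointEquiv (W.baseChange (v₀.adicCompletion ℚ)) C T) =
          .some _ _ h ∧
        (M.map (IsLocalRing.residue (v₀.adicCompletionIntegers ℚ))).toAffine.Nonsingular
          (IsLocalRing.residue (v₀.adicCompletionIntegers ℚ) a₀)
          (IsLocalRing.residue (v₀.adicCompletionIntegers ℚ) b₀))
    (M' : WeierstrassCurve (v₀.adicCompletionIntegers ℚ)) (C' : VariableChange (v₀.adicCompletion ℚ))
    (hC' : C' • W'.baseChange (v₀.adicCompletion ℚ) =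
      M'.map (algebraMap (v₀.adicCompletionIntegers ℚ) (v₀.adicCompletion ℚ)))
    (x₀' y₀' a' : IsLocalRing.ResidueField (v₀.adicCompletionIntegers ℚ))
    (hcusp' : M'.map (IsLocalRing.residue (v₀.adicCompletionIntegers ℚ)) = singularModel x₀' y₀' a' a')
    (hE0' : ∀ T : (W'.baseChange (v₀.adicCompletion ℚ)).toAffine.Point, 3 • T = 0 → T ≠ 0 →
      ∃ (a₀ b₀ : v₀.adicCompletionIntegers ℚ)
        (h : (M'.map (algebraMap (v₀.adicCompletionIntegers ℚ) (v₀.adicCompletion ℚ))).toAffine.Nonsingular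
          (a₀ : v₀.adicCompletion ℚ) (b₀ : v₀.adicCompletion ℚ)),
        Affine.Point.congrEquiv hC' (VariableChange.pointEquiv (W'.baseChange (v₀.adicCompletion ℚ)) C' T) =
          .some _ _ h ∧
        (M'.map (IsLocalRing.residue (v₀.adicCompletionIntegers ℚ))).toAffine.Nonsingular
          (IsLocalRing.residue (v₀.adicCompletionIntegers ℚ) a₀)
          (IsLocalRing.residue (v₀.adicCompletionIntegers ℚ) b₀)) :
    ∃ c : W.sha, c ≠ 0 ∧ 3 • c = 0 := by
  obtain ⟨⟨δ, hδ⟩, hn3, hnoroot⟩ := three_facts_adicCompletion_three hv₀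
  exact exists_sha_ne_zero_of_congr_of_identityComponent_of_torsionIntegral W W' θ hθ S hS hfin hcop P₁ P₂
    (fun c₁ c₂ h ↦ hind c₁ c₂ (by convert h))
    v₀ (Literature.NumberTheory.EllipticCurves.Rank1Residual.natCast_mem_asIdeal_of_primesEquiv_eq hv₀)
    (natCard_quot_three_of_primesEquiv_eq hv₀) hδ hnoroot hn3 hoff hcard hcard'
    M C hC x₀ y₀ a hcusp hE0 M' C' hC' x₀' y₀' a' hcusp' hE0'

end Summit.BirchSwinnertonDyer.Rank1Residual.GaloisImage.TwistedWitness

end
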